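import Mathlib
import Summits.AtomisticToContinuum.Crystallization.Theorems.FrustratedLawDichotomyPeriodicMuGSCExact
import Summits.AtomisticToContinuum.Crystallization.Theorems.FrustratedLawDichotomyGSCOneAtomTests

/-!
# FrustratedLawDichotomy · cruxes 27623 / 27624 — THE EXACT ONE-ATOM FLOORS OF AN EXACT PERIODIC MINIMISER, UNCONDITIONAL
# (decomp-a2c, prover hand 2, structural share, generation 5)

Generation 4 landed `FrustratedLawDichotomyBindingFloor.periodic_bindingFloor` / `periodic_vacancyFloor` — conditional on the floor statement
of item 9229 and with a `½R` repulsion correction (law-level one-atom surgeries).  With the unconditional periodic μGSC theorem of generation 5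
(`isMuGSC_points_of_exact_periodic_minimiser`) the EXACT, hypothesis-free forms follow at once from the one-atom tests of a μGSC
(`FrustratedLawDichotomyGSCOneAtomTests`): for a periodic `Q` with `e(Q) ≤ e⋆`,
* `periodic_binding_exact`   : every atom `p` is bound by at least `|e⋆|`: `Σ'_{q ∈ Q∖{p}} V_LJ(dist p q) ≤ e⋆`;
* `periodic_field_exact`     : every vacant site `z ∉ Q` has field `Σ'_{q ∈ Q} V_LJ(dist z q) ≥ e⋆`;
* `periodic_nash_exact`      : no atom can be moved to a vacant site to lower its interaction;
and the census contrapositives `eStar_lt_energyPerParticle_of_looseSite'` / `_of_deepHole'` (compare with `e(Q)` itself; no bound on `e⋆`).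
`[folklore]`.
-/

noncomputable section

namespace Summit.AtomisticToContinuum.Crystallization.Theorems.FrustratedLawDichotomyPeriodicOneAtomExact

open Literature.MathematicalPhysics.StatisticalMechanics
open Summit.AtomisticToContinuum.Crystallization.Theorems.ChargedEnergyGapNegative (E3 eStar eStar_le)
open Summit.AtomisticToContinuum.Crystallization.Theorems.FrustratedLawDichotomyPeriodicMuGSC (isMuGSC_points_of_exact_periodic_minimiser)
open Summit.AtomisticToContinuum.Crystallization.Theorems.FrustratedLawDichotomyGSCOneAtomTests
  (binding_le_of_isMuGSC field_ge_of_isMuGSC nash_of_isMuGSC)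

variable (Q : PeriodicConfiguration 3)

/-- **Exact binding floor**: in an exact periodic minimiser every atom is bound by at least `|e⋆|`. [folklore] -/
theorem periodic_binding_exact
    (hopt : Q.energyPerParticle lennardJones ≤ ⨅ Q' : PeriodicConfiguration 3, Q'.energyPerParticle lennardJones)
    {p : E3} (hp : p ∈ Q.points) :
    ∑' q : ↥(Q.points \ {p}), lennardJones (dist p q) ≤ ⨅ Q' : PeriodicConfiguration 3, Q'.energyPerParticle lennardJones :=
  binding_le_of_isMuGSC (isMuGSC_points_of_exact_periodic_minimiser Q hopt) hp

/-- **Exact vacancy floor**: in an exact periodic minimiser every vacant site has field `≥ e⋆`. [folklore] -/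
theorem periodic_field_exact
    (hopt : Q.energyPerParticle lennardJones ≤ ⨅ Q' : PeriodicConfiguration 3, Q'.energyPerParticle lennardJones)
    {z : E3} (hz : z ∉ Q.points) :
    (⨅ Q' : PeriodicConfiguration 3, Q'.energyPerParticle lennardJones) ≤ ∑' q : ↥Q.points, lennardJones (dist z q) :=
  field_ge_of_isMuGSC (isMuGSC_points_of_exact_periodic_minimiser Q hopt) hz

/-- **Exact Nash property**: in an exact periodic minimiser no atom can be moved (off the other atoms) to lower its interaction. [folklore] -/
theorem periodic_nash_exact
    (hopt : Q.energyPerParticle lennardJones ≤ ⨅ Q' : PeriodicConfiguration 3, Q'.energyPerParticle lennardJones)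
    {p : E3} (hp : p ∈ Q.points) (y : E3) (hy : ∀ q ∈ Q.points, q ≠ p → y ≠ q) :
    ∑' q : ↥(Q.points \ {p}), lennardJones (dist p q) ≤ ∑' q : ↥(Q.points \ {p}), lennardJones (dist y q) :=
  nash_of_isMuGSC (isMuGSC_points_of_exact_periodic_minimiser Q hopt) hp y hy

/-- **Census contrapositive (loose site, exact form)**: an atom `p` of a periodic `Q` with `Σ'_{q ∈ Q∖{p}} V_LJ(dist p q) > e(Q)` certifies
`e⋆ < e(Q)` (compare with `e(Q)` itself — no bound on `e⋆`). [folklore] -/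
theorem eStar_lt_energyPerParticle_of_looseSite' {p : E3} (hp : p ∈ Q.points)
    (hloose : Q.energyPerParticle lennardJones < ∑' q : ↥(Q.points \ {p}), lennardJones (dist p q)) :
    (⨅ Q' : PeriodicConfiguration 3, Q'.energyPerParticle lennardJones) < Q.energyPerParticle lennardJones := by
  by_contra hle
  rw [not_lt] at hle
  have heq : Q.energyPerParticle lennardJones = ⨅ Q' : PeriodicConfiguration 3, Q'.energyPerParticle lennardJones :=
    le_antisymm hle (eStar_le Q)
  have h := periodic_binding_exact Q hle hp
  rw [← heq] at h
  exact absurd h (not_le.2 hloose)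

/-- **Census contrapositive (deep hole, exact form)**: a vacant site `z` of a periodic `Q` with field `Σ'_{q ∈ Q} V_LJ(dist z q) < e(Q)` certifies
`e⋆ < e(Q)`. [folklore] -/
theorem eStar_lt_energyPerParticle_of_deepHole' {z : E3} (hz : z ∉ Q.points)
    (hdeep : ∑' q : ↥Q.points, lennardJones (dist z q) < Q.energyPerParticle lennardJones) :
    (⨅ Q' : PeriodicConfiguration 3, Q'.energyPerParticle lennardJones) < Q.energyPerParticle lennardJones := by
  by_contra hle
  rw [not_lt] at hle
  have heq : Q.energyPerParticle lennardJones = ⨅ Q' : PeriodicConfiguration 3, Q'.energyPerParticle lennardJones :=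
    le_antisymm hle (eStar_le Q)
  have h := periodic_field_exact Q hle hz
  rw [← heq] at h
  exact absurd h (not_le.2 hdeep)

end Summit.AtomisticToContinuum.Crystallization.Theorems.FrustratedLawDichotomyPeriodicOneAtomExact

end
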